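import Literature.NumberTheory.EllipticCurves.Muller2020.TrivialBranch
import Literature.NumberTheory.EllipticCurves.Muller2020.NuBranchPeriodRigidity
import Summits.BirchSwinnertonDyer.BirchSwinnertonDyer.Theorems.PrintCf2RubinValueTwoLinePinEulerFactorNorm
import HarnessLib

/-!
# M-LINE-PIN, stub (T): the ANALYTIC input (A_T) of the trivial branch — `(π_v G) = (G₁)` on the `v`-line from the
# node values (core rigidity step)

Cell `bsd-print-cf2`, WIDTH seat `bsd-line-cf2-p1-w5` g8 (prover-bsd-line-cf2-p1-w5-g8-0). Helper, Theses-free, `--supports` the M-LINE-PIN item.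
HONEST FRAMING. (A_T) is the input `hA` of `LinePinThetaOne.thetaLine_of_powForm_of_restriction` (file
`…LinePinThetaLineOfInputs`): for the TRIVIAL branch (`λ = 1`, `S = ∅`) and a two-variable Katz measure `G`, the restriction
`P := G(T₁, 0)` to the `v`-line generates the same ideal of `𝒪_{ℂ₂}⟦T⟧` as Müller's REGULARISED pseudo-branch `G₁`
(`IsNuPseudoBranch ι v κ₁ γ₁⁻¹ 1 Ω′ Ω_p′ G₁`), and `P ≠ 0`. THIS FILE proves the CORE STEP from displayed node data
(`span_eq_span_of_trivialBranch_values`): given `P` an `IsNuBranch` of modulus `{v̄}` and `G₁` a pseudo-branch, a family of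
in-range characters `ρ_t` on the `v`-line with nodes `w·uᵗ − 1` (the shape of cf2c-w3 g6's `VLineSupply.exists_vLineSupply` at
`θ_K = 1`) and the avatar dictionary at `v̄` read at an element `φ` with `κ₁ φ` a UNIT (ty2 g36's `exists_frob_dictionary` /
`isUnit_toAdd_apply_absGaloisRestrict`), then `span {P} = span {G₁}` and `P ≠ 0`. MECHANISM (de Shalit II.4.12 (ii)–(iii),
Müller Cor. 4.3 "e = 1"): the Euler factor `e = 1 − (1+T)^{−κ₁φ}` times `G₁` and the regulariser `f = 1 − (1+T)^{−1}` times `P`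
take at every node the SAME value `(1 − r_t(γ₁⁻¹)⁻¹)·L_{2,v̄}(ρ_t)` for the two period pairs (ty2 g35's
`IsNuPseudoBranch.hasValueAt_eulerFactor_mul_inv` / `IsNuBranch.hasValueAt_one_sub_binomPow_mul_inv`); the common factor is
ALGEBRAIC (`1 − det r_t(γ₁⁻¹)⁻¹ ∈ ℚ̄₂`) and is folded into the `L`-value slot of `interpolationValue₀` (linear in it), so ty2
g36's period rigidity `span_eq_span_of_interpolationValue₀_values` (p708075; NO unit content) gives `(f·P) = (e·G₁)`; both
`(e)` and `(f)` are `(X)` (-w6 g7's brick `EulerFactorNorm.span_one_sub_C_mul_binomPow_eq_span_of_isUnit` at `u = 1`), and `X`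
cancels in the domain `𝒪_{ℂ₂}⟦T⟧`. The wrapper feeding cf2c-w3's supply and ty2's dictionary by name is the sequel file. No
summit statement is proved by this seat; BSD is not proved by any of this. THEOREMS ONLY (no definition, no named fact, no
`sorry`). beyond-print theorem: no.

References: [deShalit1987] II Thm. 4.12 (ii)–(iii) and Remarks (iii)–(iv); [Mueller2020MCSplitTwo] Def. 2.5 (χ = 1), Cor. 4.3;
[Washington1997] §7.1.
-/

noncomputable section

open scoped Classical

-- the summit namespace `Summit.BirchSwinnertonDyer.BirchSwinnertonDyer` repeats the problem name by design (D-0017)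
set_option linter.dupNamespace false
set_option autoImplicit false

open NumberField IsDedekindDomain Field Literature.NumberTheory.GaloisRepresentations
  Literature.NumberTheory.EllipticCurves Literature.NumberTheory.EllipticCurves.GreenbergVatsal2000
  Literature.NumberTheory.EllipticCurves.Muller2020
  Summit.BirchSwinnertonDyer.BirchSwinnertonDyer.Theorems.PrintCf2

namespace Summit.BirchSwinnertonDyer.BirchSwinnertonDyer.Theorems.PrintCf2.LinePinThetaOne

/-! ## §1. Algebra: folding an algebraic factor into the `L`-value slot; spans of the two factors; cancelling `X` -/

section Algebra

variable {K : Type} [Field K] [NumberField K] {p : ℕ} [Fact p.Prime]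

omit [Fact p.Prime] in
/-- `interpolationValue₀` is LINEAR in its `L`-value slot. [cite: deShalit1987, II Thm. 4.12 (31)] -/
theorem interpolationValue₀_mul_lval (v : HeightOneSpectrum (𝓞 K)) (T : Finset (HeightOneSpectrum (𝓞 K))) (ε : HeckeCharacter K)
    (m : ℕ) (Ω c L : ℂ) : interpolationValue₀ p v T ε m Ω (c * L) = c * interpolationValue₀ p v T ε m Ω L := by
  unfold interpolationValue₀; ring

/-- **Folding an ALGEBRAIC factor into the `L`-value slot**: `α · (ι⁻¹(IV₀(…, L)) · Ω_q^m) = ι⁻¹(IV₀(…, ι(α)·L)) · Ω_q^m` for `α ∈ ℚ̄_p`.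
[cite: deShalit1987, II Thm. 4.12 (31) and Remark (iii)] -/
theorem coe_mul_interpolationValue₀_eq (ι : PadicAlgCl p ≃+* ℂ) (α : PadicAlgCl p) (v : HeightOneSpectrum (𝓞 K))
    (T : Finset (HeightOneSpectrum (𝓞 K))) (ε : HeckeCharacter K) (m : ℕ) (Ω L : ℂ) (Ωq : ℂ_[p]) :
    (α : ℂ_[p]) * (((ι.symm (interpolationValue₀ p v T ε m Ω L) : PadicAlgCl p) : ℂ_[p]) * Ωq ^ m) =
      ((ι.symm (interpolationValue₀ p v T ε m Ω (ι α * L)) : PadicAlgCl p) : ℂ_[p]) * Ωq ^ m := by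
  rw [interpolationValue₀_mul_lval, map_mul, RingEquiv.symm_apply_apply]
  simp only [PadicComplex.coe_eq, map_mul]
  ring

omit [NumberField K] in
/-- The regularising factor `1 − r(γ)⁻¹` at an avatar value is (the image of) an element of `ℚ̄_p`.
[cite: deShalit1987, II.4.17 (52)–(53)] -/
theorem one_sub_inv_avatarValueAt_eq_coe (r : FramedGaloisRep K (PadicAlgCl p) 1) (σ : absoluteGaloisGroup K) :
    1 - (avatarValueAt r σ)⁻¹ =
      (((1 : PadicAlgCl p) - (((Matrix.GeneralLinearGroup.det (r σ) : (PadicAlgCl p)ˣ) : PadicAlgCl p))⁻¹ : PadicAlgCl p) : ℂ_[p]) := by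
  rw [avatarValueAt, PadicComplex.coe_eq, PadicComplex.coe_eq, map_sub, map_one, map_inv₀]

/-- A one-unit-close element of `ℂ_p` is integral: `‖w − 1‖ < 1 ⟹ ‖w‖ ≤ 1`. [cite: Gouvea1993PadicNumbers, §5.6 Cor. 5.6.4] -/
theorem norm_le_one_of_norm_sub_one_lt {w : ℂ_[p]} (hw : ‖w - 1‖ < 1) : ‖w‖ ≤ 1 := by
  have h := IsUltrametricDist.norm_add_le_max (w - 1) (1 : ℂ_[p])
  rw [sub_add_cancel, norm_one] at h
  exact h.trans (max_le hw.le le_rfl)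

/-- `(1 − (1+X)^c) = (X)` as ideals of `𝒪_{ℂ₂}⟦X⟧` for `c ∈ ℤ₂ˣ` (-w6 g7's brick at `u = 1`). [cite: Washington1997, §7.1] -/
theorem span_one_sub_binomPow_eq_span_X {c : ℤ_[2]} (hc : IsUnit c) :
    Ideal.span ({1 - IntSeries.binomPow c} : Set (PowerSeries (PadicComplexInt 2))) = Ideal.span {PowerSeries.X} := by
  have h := EulerFactorNorm.span_one_sub_C_mul_binomPow_eq_span_of_isUnit 1 (Or.inl rfl) hc
  rwa [Int.cast_one, Int.cast_one, map_one, one_mul, add_sub_cancel_left] at h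

/-- The same with the factor written `1 − C 1 · (1+X)^c` (the shape of ty2's Euler factor at `a = 1`). [cite: Washington1997, §7.1] -/
theorem span_one_sub_C_one_mul_binomPow_eq_span_X {c : ℤ_[2]} (hc : IsUnit c) :
    Ideal.span ({1 - PowerSeries.C (1 : PadicComplexInt 2) * IntSeries.binomPow c} : Set (PowerSeries (PadicComplexInt 2))) =
      Ideal.span {PowerSeries.X} := by
  rw [map_one, one_mul]; exact span_one_sub_binomPow_eq_span_X hc

/-- `1 − (1+X)^c ≠ 0` for `c ∈ ℤ₂ˣ`. [cite: Washington1997, §7.1] -/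
theorem one_sub_binomPow_ne_zero {c : ℤ_[2]} (hc : IsUnit c) : (1 - IntSeries.binomPow c : PowerSeries (PadicComplexInt 2)) ≠ 0 := by
  intro h
  have h1 := span_one_sub_binomPow_eq_span_X hc
  rw [h, Ideal.span_singleton_eq_bot.mpr rfl, eq_comm, Ideal.span_singleton_eq_bot] at h1
  exact PowerSeries.X_ne_zero h1

/-- **Cancelling `X`**: `(X)·(P) = (X)·(Q) ⟹ (P) = (Q)` in the domain `𝒪_{ℂ₂}⟦X⟧`. [cite: Washington1997, §7.1] -/
theorem span_eq_span_of_span_X_mul_eq {P Q : PowerSeries (PadicComplexInt 2)}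
    (h : Ideal.span ({PowerSeries.X} : Set (PowerSeries (PadicComplexInt 2))) * Ideal.span {P} = Ideal.span {PowerSeries.X} * Ideal.span {Q}) :
    Ideal.span ({P} : Set (PowerSeries (PadicComplexInt 2))) = Ideal.span {Q} := by
  rw [Ideal.span_singleton_mul_span_singleton, Ideal.span_singleton_mul_span_singleton, Ideal.span_singleton_eq_span_singleton] at h
  exact Ideal.span_singleton_eq_span_singleton.mpr (h.of_mul_left (Associated.refl _) PowerSeries.X_ne_zero)

end Algebra

/-! ## §2. The core step: `(P) = (G₁)` from the node values on the `v`-line -/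

section Core

variable {K : Type} [Field K] [NumberField K]

/-- **(A_T), CORE: `(π_v G) = (G₁)` AND `π_v G ≠ 0` FROM THE NODE DATA.** `P` an `IsNuBranch ι v {v̄} κ₁ γ₁⁻¹ 1 Ω Ω_p` solution (the
restriction of a Katz measure of the trivial branch), `G₁ ≠ 0` an `IsNuPseudoBranch ι v κ₁ γ₁⁻¹ 1 Ω′ Ω_p′` solution (Müller's regularised
pseudo-branch), a supply of everywhere-unramified characters `ρ_t` of type `(−(m₀ + N t), 0)` through `κ₁` with nodes `r_t(γ₁⁻¹) = w uᵗ`, and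
the dictionary at `v̄` `ι⁻¹(ρ_t(ϖ_v̄)) = r_t(φ)` at an element `φ` with `κ₁ φ ∈ ℤ₂ˣ` ⟹ `P ≠ 0 ∧ (P) = (G₁)`.
[cite: deShalit1987, II Thm. 4.12 (ii)–(iii) (32) and Remarks (iii)–(iv)] [cite: Mueller2020MCSplitTwo, Def. 2.5 (χ = 1), Cor. 4.3] -/
theorem span_eq_span_of_trivialBranch_values {ι : PadicAlgCl 2 ≃+* ℂ} {v vbar : HeightOneSpectrum (𝓞 K)} {κ₁ : ZpExtension K 2}
    {γ₁ : absoluteGaloisGroup K} (hγ : κ₁.IsTopGenerator γ₁) {Ω Ω' : ℂ} {Ωp Ωp' : ℂ_[2]} (hΩ : Ω ≠ 0) (hΩ' : Ω' ≠ 0) (hΩp : Ωp ≠ 0)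
    (hΩp' : Ωp' ≠ 0) {P G₁ : PowerSeries (PadicComplexInt 2)} (hP : IsNuBranch ι v {vbar} κ₁ γ₁⁻¹ (1 : HeckeCharacter K) Ω Ωp P)
    (hG₁ : IsNuPseudoBranch ι v κ₁ γ₁⁻¹ (1 : HeckeCharacter K) Ω' Ωp' G₁) (hG₁0 : G₁ ≠ 0)
    (φ : absoluteGaloisGroup K) (hφ : IsUnit (Multiplicative.toAdd (κ₁ φ)))
    {ρ : ℕ → HeckeCharacter K} {r : ℕ → FramedGaloisRep K (PadicAlgCl 2) 1} {w u : ℂ_[2]} {m₀ N : ℕ} (hm₀ : 0 < m₀) (hN : 0 < N)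
    (hw : ‖w - 1‖ < 1) (hu : ‖u - 1‖ < 1) (hroot : ∀ n : ℕ, 0 < n → u ^ n ≠ 1)
    (hr : ∀ t : ℕ, IsPAdicAvatarOf ι (ρ t) (r t)) (hκ : ∀ t : ℕ, FactorsThroughZp κ₁ (r t))
    (hnode : ∀ t : ℕ, avatarValueAt (r t) γ₁⁻¹ = w * u ^ t)
    (hinf : ∀ t : ℕ, ((1 : HeckeCharacter K) * ρ t).HasInfinityType (fun _ ↦ -((m₀ + N * t : ℕ) : ℤ)) (fun _ ↦ (0 : ℤ)))
    (hunr : ∀ (t : ℕ) (w' : HeightOneSpectrum (𝓞 K)), ((1 : HeckeCharacter K) * ρ t).IsUnramifiedAt w')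
    (hL : ∀ t : ℕ, LFunction.HasEntireContinuation (heckeLFunction ((1 : HeckeCharacter K) * ρ t)))
    (hdict : ∀ t : ℕ, ((ι.symm (heckeValueExtZero ((1 : HeckeCharacter K) * ρ t) vbar) : PadicAlgCl 2) : ℂ_[2]) =
      ((1 : PadicComplexInt 2) : ℂ_[2]) * avatarValueAt (r t) φ) :
    P ≠ 0 ∧ Ideal.span ({P} : Set (PowerSeries (PadicComplexInt 2))) = Ideal.span {G₁} := by
  -- the algebraic regularising factors and the folded `L`-values
  set α : ℕ → PadicAlgCl 2 := fun t ↦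
    1 - (((Matrix.GeneralLinearGroup.det ((r t) γ₁⁻¹) : (PadicAlgCl 2)ˣ) : PadicAlgCl 2))⁻¹ with hα
  set L : ℕ → ℂ := fun t ↦ ι (α t) * (hL t).continuation 0 with hLdef
  have hαt : ∀ t : ℕ, 1 - (avatarValueAt (r t) γ₁⁻¹)⁻¹ = ((α t : PadicAlgCl 2) : ℂ_[2]) := fun t ↦
    one_sub_inv_avatarValueAt_eq_coe (r t) γ₁⁻¹
  -- the integral lift of `w`
  set w₀ : PadicComplexInt 2 := ⟨w, mem_padicComplexInt_iff.mpr (norm_le_one_of_norm_sub_one_lt hw)⟩ with hw₀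
  have hw₀c : ((w₀ : PadicComplexInt 2) : ℂ_[2]) = w := rfl
  have hw' : ‖((w₀ : PadicComplexInt 2) : ℂ_[2]) - 1‖ < 1 := by rw [hw₀c]; exact hw
  -- the two products: `f · P` and `e · G₁`
  have hPt : ∀ t : ℕ, IntSeries.HasValueAt ((1 - IntSeries.binomPow (-1 : ℤ_[2])) * P) (((w₀ : PadicComplexInt 2) : ℂ_[2]) * u ^ t - 1)
      (((ι.symm (interpolationValue₀ 2 v {vbar} ((1 : HeckeCharacter K) * ρ t) (m₀ + N * t) Ω (L t)) : PadicAlgCl 2) : ℂ_[2]) *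
        Ωp ^ (m₀ + N * t)) := fun t ↦ by
    have h := hP.hasValueAt_one_sub_binomPow_mul_inv hγ (hr t) (hκ t) (Nat.add_pos_left hm₀ _) (hinf t) (fun w' _ ↦ hunr t w') (hL t)
    rwa [hαt t, coe_mul_interpolationValue₀_eq, hnode t, ← hw₀c] at h
  have hQt : ∀ t : ℕ, IntSeries.HasValueAt
      ((1 - PowerSeries.C (1 : PadicComplexInt 2) * IntSeries.binomPow (-(Multiplicative.toAdd (κ₁ φ)))) * G₁)
      (((w₀ : PadicComplexInt 2) : ℂ_[2]) * u ^ t - 1)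
      (((ι.symm (interpolationValue₀ 2 v {vbar} ((1 : HeckeCharacter K) * ρ t) (m₀ + N * t) Ω' (L t)) : PadicAlgCl 2) : ℂ_[2]) *
        Ωp' ^ (m₀ + N * t)) := fun t ↦ by
    have h := hG₁.hasValueAt_eulerFactor_mul_inv hγ vbar φ 1 (hr t) (hκ t) (Nat.add_pos_left hm₀ _) (hinf t) (hunr t) (hdict t) (hL t)
    rwa [hαt t, coe_mul_interpolationValue₀_eq, hnode t, ← hw₀c] at h
  -- `e · G₁ ≠ 0`
  have he0 : (1 - PowerSeries.C (1 : PadicComplexInt 2) * IntSeries.binomPow (-(Multiplicative.toAdd (κ₁ φ))) :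
      PowerSeries (PadicComplexInt 2)) ≠ 0 := by
    rw [map_one, one_mul]; exact one_sub_binomPow_ne_zero hφ.neg
  have hQ0 : (1 - PowerSeries.C (1 : PadicComplexInt 2) * IntSeries.binomPow (-(Multiplicative.toAdd (κ₁ φ)))) * G₁ ≠ 0 :=
    mul_ne_zero he0 hG₁0
  -- period rigidity (ty2 g36, p708075): `(f · P) = (e · G₁)`
  have hspan := span_eq_span_of_interpolationValue₀_values (p := 2) (m := fun t ↦ m₀ + N * t) hw' hu hroot (fun _ ↦ rfl) hN
    hΩ hΩ' hΩp hΩp' hPt hQt hQ0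
  -- `(f) = (X) = (e)`, cancel `X`
  rw [← Ideal.span_singleton_mul_span_singleton, ← Ideal.span_singleton_mul_span_singleton,
    span_one_sub_binomPow_eq_span_X (isUnit_one.neg), span_one_sub_C_one_mul_binomPow_eq_span_X hφ.neg] at hspan
  have hPG := span_eq_span_of_span_X_mul_eq hspan
  refine ⟨fun hP0 ↦ hG₁0 ?_, hPG⟩
  rw [hP0, Ideal.span_singleton_eq_bot.mpr rfl, eq_comm, Ideal.span_singleton_eq_bot] at hPG
  exact hPG

end Core

end Summit.BirchSwinnertonDyer.BirchSwinnertonDyer.Theorems.PrintCf2.LinePinThetaOne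

end
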